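import Literature.Analysis.FluidPDE.CheskidovShvydkoyApriori
import Literature.Analysis.FluidPDE.LittlewoodPaleyFields
import Literature.Analysis.FluidPDE.LerayLocalRegularH1
import Literature.Analysis.FluidPDE.TaoLocalisationProofs
import Literature.Analysis.FluidPDE.NSSerrinRegularityProofs
import HarnessLib

/-!
# Cheskidov–Shvydkoy's Lemma 3.2 proved, and Theorem 3.1 from Leray's local theory

Analysis/FluidPDE file serving the discharge of `Literature.Analysis.FluidPDE.cheskidov_shvydkoy`
(ns.S31; Cheskidov–Shvydkoy, *The regularity of weak solutions of the 3D Navier–Stokes equations in*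
`B^{-1}_{∞,∞}`, Arch. Ration. Mech. Anal. 195 (2010) 159–169 = arXiv:0708.3067). The accepted
reduction `cheskidov_shvydkoy_of_local_regular` (`LerayLocalRegularH1.lean`) splits Theorem 3.1 into
Lemma 3.2 (`cheskidov_shvydkoy_dyadic_regular`), Leray's local regular theory in `H¹`
(`leray_local_regular_H1`, named fact) and the Ladyzhenskaya–Prodi–Serrin theorem
(`ladyzhenskaya_prodi_serrin`, ns.S07). This file **proves Lemma 3.2 from `leray_local_regular_H1`**
(`cheskidov_shvydkoy_dyadic_regular_of_local_regular`), assembling the Littlewood–Paley machinery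
built for the purpose (`LittlewoodPaleyKernel/SquareFunction/Products/Smooth/Fields`,
`ParaproductSums`, `CheskidovShvydkoyBlockTime/BlockEnergy/Nonlinear/DyadicEnergy/Apriori`,
`SupGronwall`):

* `nonempty_lpBounds`, `lpBounds`: the Littlewood–Paley constants package `LPBounds ι` is inhabited
  (Bernstein, reverse Bernstein, square function — all proved);
* `isSmoothSlabSolution_of_regular`, `exists_gradSq_thirdSum_le`: a compact sub-slab `[a, b] ⊂ (0, δ]`
  of a regular solution (the clauses of `LerayLocalRegularH1With`) is a smooth slab solution with
  uniform data (Sobolev imbedding `H²(ℝ³) ⊂ L^∞` componentwise, `isSmoothL2Field_of_sobolev`,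
  `ContinuousMultilinearMap.norm_le_sum_norm_apply_basis`, `norm_iteratedFDeriv_iteratedFDeriv`);
* `piece`: from a good restarting time `σ`, weak–strong uniqueness
  (`serrin_weak_strong_uniqueness_holds`) identifies `u(σ + ·)` with the regular solution, so the
  dyadic energy `f(t) = F(u(t)).toReal` obeys the two-point inequality of
  `IsSmoothSlabSolution.dyadicF_two_point` on every `[σ + a', σ + b']`;
* `TwoPointOn.chain`, `TwoPointOn.le_mul_exp`: two-point inequalities chain over overlapping
  intervals and give Gronwall bounds;
* `exists_eH1NormSq_le_of_isH1RegularOn`: **the bootstrap** — along an interval of regularity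
  `(α, β)`, restarting at good times with the uniform lifespan attached to the Gronwall bound
  `F^* = (f(s₁) + G(β - s₁)) e^{2K(β - s₁)}`, the enstrophy stays bounded up to `β`
  (CS p. 6: "Gronwall's Lemma implies that `u(t)` is bounded in `H^s` up to `t = β`. Hence by
  Theorem 2.4, `u(t)` is regular on `(0,T]`");
* `exists_blockSup_le_of_limsup_lt`: the printed hypothesis
  `limsup_q sup_t 2^{-q}‖Δ̇_q u(t)‖_∞ < c ν` through the dictionary `lpBlockWeight_top_eq`;
* `cheskidov_shvydkoy_dyadic_regular_of_local_regular` (**Lemma 3.2**, absolute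
  `c = (18·2570·(C₂+1)(C_r+1))⁻¹`), `cheskidov_shvydkoy_of_leray_local_regular_H1` (**Thm. 3.1**
  from `leray_local_regular_H1` and `ladyzhenskaya_prodi_serrin`) and
  `cheskidov_shvydkoy_of_local_H1_theory` (from `leray_local_regular_H1` and
  `tao2011_H1_local_almost_regular`, through `ladyzhenskaya_prodi_serrin_of_local_H1_theory`).

The tree's version of Lemma 3.2 is the `H¹` (`s = 1`) energy estimate with Bony's decomposition
in divergence form (module docstrings of `ParaproductSums` and `CheskidovShvydkoyApriori`), which
avoids the `H^{(1+ε)/2}` local theory of the printed proof; the constants are independent of the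
`H¹` norm, which is what the continuation needs.

## References

* A. Cheskidov, R. Shvydkoy, Arch. Ration. Mech. Anal. 195 (2010) 159–169 = arXiv:0708.3067,
  Thm. 3.1, Lemma 3.2, Thm. 2.4, pp. 4–6. [CheskidovShvydkoy2010]
* J. C. Robinson, J. L. Rodrigo, W. Sadowski, *The Three-Dimensional Navier–Stokes Equations*,
  CUP 2016, Thm. 6.15, Lemma 6.11, Thm. 8.14, Thm. 8.19. [RobinsonRodrigoSadowski2016]
* W. S. Ożański, B. C. Pooley, in: PDE in Fluid Mechanics, LMS LN 452, CUP 2018, Thm. 6.30,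
  Cor. 6.16. [OzanskiPooley2018]
-/

noncomputable section

open MeasureTheory Filter Topology Function Set
open Literature.Analysis.FunctionSpaces
open scoped ENNReal NNReal RealInnerProductSpace

namespace Literature.Analysis.FluidPDE

open LPBounds

section Congr

variable {ι : Type*} [Fintype ι]

/-- Block norms ignore null sets. [folklore] -/
theorem blockL2_congr_ae {u v : EuclideanSpace ℝ ι → EuclideanSpace ℝ ι} (h : u =ᵐ[volume] v) :
    blockL2 u = blockL2 v := by
  funext l; unfold blockL2; rw [blockFn_congr_ae l h]

/-- Block sup norms ignore null sets. [folklore] -/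
theorem blockSup_congr_ae {u v : EuclideanSpace ℝ ι → EuclideanSpace ℝ ι} (h : u =ᵐ[volume] v) :
    blockSup u = blockSup v := by
  funext l; unfold blockSup; rw [blockFn_congr_ae l h]

/-- The dyadic energy ignores null sets. [folklore] -/
theorem dyadicF_congr_ae {u v : EuclideanSpace ℝ ι → EuclideanSpace ℝ ι} (h : u =ᵐ[volume] v) :
    dyadicF u = dyadicF v := by
  unfold dyadicF; rw [blockL2_congr_ae h]

end Congr

/-! ## The Littlewood–Paley toolbox on `ℝ³` -/

section Toolbox

variable {ι : Type*} [Fintype ι] [Nonempty ι]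

/-- **The Littlewood–Paley constants exist** in every positive dimension: `LPBounds ι` is
inhabited, each field being a proved theorem of `LittlewoodPaleyFields.lean` /
`LittlewoodPaleyBlockFn.lean` (Bernstein, reverse Bernstein, square function). [folklore] -/
theorem nonempty_lpBounds : Nonempty (LPBounds ι) := by
  obtain ⟨C₂, hC₂⟩ := exists_eLpNorm_blockFn_two_le (E := EuclideanSpace ℝ ι) (ι := ι)
  obtain ⟨Cb, hCb⟩ := exists_eLpNorm_fderiv_blockFn_le (E := EuclideanSpace ℝ ι) (ι := ι)
  obtain ⟨Cr, hCr⟩ := exists_eLpNorm_blockFn_le_sum_fderiv (E := EuclideanSpace ℝ ι) (ι := ι)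
    (stdOrthonormalBasis ℝ (EuclideanSpace ℝ ι))
  obtain ⟨Cinf, hCinf⟩ := exists_eLpNorm_top_blockFn_le (E := EuclideanSpace ℝ ι) (ι := ι)
  exact ⟨⟨C₂, Cb, Cr, Cinf, (fun j f hf => hC₂ j f hf),
    (fun m j v hv => hCb m j v (IsC1L2Field.of_isSmoothL2Field hv)),
    (fun j v hv => hCr j v (IsC1L2Field.of_isSmoothL2Field hv)),
    (fun j v hv => hCinf j v hv),
    (fun v hv => tendsto_eLpNorm_sub_sum_blockFn hv),
    (fun v hv => tsum_eLpNorm_blockFn_sq_le hv),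
    (fun v hv => eLpNorm_sq_le_two_mul_tsum_eLpNorm_blockFn_sq hv)⟩⟩

/-- A fixed choice of the Littlewood–Paley constants. [folklore] -/
def lpBounds (ι : Type*) [Fintype ι] [Nonempty ι] : LPBounds ι := Classical.choice nonempty_lpBounds

end Toolbox

/-! ## The gradient energy of smooth fields is the weak dissipation -/

section GradSq

variable {ι : Type*} [Fintype ι]

/-- For a smooth `L²` field the weak dissipation `Fluid.eWeakGradL2Sq` is `∑_i ‖∂_i v‖²₂`. [folklore] -/
theorem gradSq_eq_eWeakGradL2Sq {v : EuclideanSpace ℝ ι → EuclideanSpace ℝ ι} (hv : IsSmoothL2Field v) :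
    gradSq v = eWeakGradL2Sq v := by
  rw [eWeakGradL2Sq_eq_of_hasWeakGradient (hasWeakGradient_fderiv_of_contDiff (hv.contDiff_nat 1))]
  unfold gradSq
  have hterm : ∀ i, eLpNorm (fun x => fderiv ℝ v x (stdOrthonormalBasis ℝ (EuclideanSpace ℝ ι) i)) 2 volume ^ 2 =
      ∫⁻ x, ‖fderiv ℝ v x (stdOrthonormalBasis ℝ (EuclideanSpace ℝ ι) i)‖ₑ ^ 2 := fun i =>
    Literature.Analysis.FunctionSpaces.eLpNorm_two_sq_eq_lintegral _
  simp_rw [hterm]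
  rw [← lintegral_finsetSum' _ fun i _ => ((hv.memLp_fderiv_apply _).1.enorm.pow_const 2)]
  refine lintegral_congr fun x => ?_
  rw [frobeniusNormSq, ENNReal.ofReal_sum_of_nonneg fun i _ => sq_nonneg _]
  refine Finset.sum_congr rfl fun i _ => ?_
  rw [← ofReal_norm, ENNReal.ofReal_pow (norm_nonneg _)]

end GradSq

end Literature.Analysis.FluidPDE

namespace Literature.Analysis.FluidPDE

/-! ## Iterated derivatives of iterated derivatives -/

section IterNorm

universe u

/-- `‖D^j (D^n f)(x)‖ = ‖D^{n+j} f(x)‖` (induction on `n` through `iteratedFDeriv_succ_eq_comp_right`,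
the curry isometries and `norm_iteratedFDeriv_fderiv`; domain and codomain in one universe so that
the induction can pass to `Df`). [folklore] -/
theorem norm_iteratedFDeriv_iteratedFDeriv {X : Type u} [NormedAddCommGroup X] [NormedSpace ℝ X] :
    ∀ {Y : Type u} [NormedAddCommGroup Y] [NormedSpace ℝ Y] {f : X → Y} (n j : ℕ) (x : X),
    ‖iteratedFDeriv ℝ j (iteratedFDeriv ℝ n f) x‖ = ‖iteratedFDeriv ℝ (n + j) f x‖ := by
  intro Y _ _ f n
  induction n generalizing Y with
  | zero =>
    intro j x
    rw [zero_add, iteratedFDeriv_zero_eq_comp]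
    exact LinearIsometryEquiv.norm_iteratedFDeriv_comp_left (continuousMultilinearCurryFin0 ℝ X Y).symm f x j
  | succ n ih =>
    intro j x
    have hrep : iteratedFDeriv ℝ (n + 1) f =
        (continuousMultilinearCurryRightEquiv' ℝ n X Y).symm ∘ iteratedFDeriv ℝ n (fun y => fderiv ℝ f y) := by
      funext y; exact iteratedFDeriv_succ_eq_comp_right
    rw [hrep]
    have h1 := LinearIsometryEquiv.norm_iteratedFDeriv_comp_left (continuousMultilinearCurryRightEquiv' ℝ n X Y).symm
      (iteratedFDeriv ℝ n (fun y => fderiv ℝ f y)) x j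
    rw [h1, ih j x, Nat.add_right_comm]
    exact norm_iteratedFDeriv_fderiv

end IterNorm

end Literature.Analysis.FluidPDE

namespace Literature.Analysis.FluidPDE

/-! ## Smooth slab solutions out of Leray's regular solutions (`ℝ³`) -/

section SlabBuild

open LPBounds

local notation "ℝ3" => EuclideanSpace ℝ (Fin 3)

/-- **The norm of a multilinear map is controlled by its values on an orthonormal basis**:
`‖M‖ ≤ ∑_σ ‖M(b_{σ(1)}, …, b_{σ(n)})‖`. [folklore] -/
theorem _root_.ContinuousMultilinearMap.norm_le_sum_norm_apply_basis {X : Type*} [NormedAddCommGroup X]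
    [InnerProductSpace ℝ X] {κ : Type*} [Fintype κ] {F : Type*} [NormedAddCommGroup F] [NormedSpace ℝ F]
    {n : ℕ} (b : OrthonormalBasis κ ℝ X) (M : ContinuousMultilinearMap ℝ (fun _ : Fin n => X) F) :
    ‖M‖ ≤ ∑ σ : Fin n → κ, ‖M (fun i => b (σ i))‖ := by
  classical
  refine M.opNorm_le_bound (Finset.sum_nonneg fun σ _ => norm_nonneg _) fun y => ?_
  have hy : y = fun i => ∑ k, ⟪b k, y i⟫ • b k := funext fun i => (b.sum_repr' (y i)).symm
  conv_lhs => rw [hy]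
  rw [ContinuousMultilinearMap.map_sum M (fun i k => ⟪b k, y i⟫ • b k)]
  refine (norm_sum_le _ _).trans ?_
  rw [Finset.sum_mul]
  refine Finset.sum_le_sum fun σ _ => ?_
  rw [ContinuousMultilinearMap.map_smul_univ, norm_smul, mul_comm]
  gcongr
  rw [Real.norm_eq_abs, Finset.abs_prod]
  exact Finset.prod_le_prod (fun i _ => abs_nonneg _) fun i _ =>
    (abs_real_inner_le_norm _ _).trans (by rw [b.orthonormal.1, one_mul])

/-- A smooth function on `ℝ³` all of whose derivatives are square integrable is a smooth `L²`
field: each component `Dⁿ g(x)(e_σ)` is bounded by the Sobolev imbedding `H²(ℝ³) ⊂ L^∞`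
(`FunctionSpaces.exists_enorm_le_sobolev_two_two_dim_three`) since its `j`-th derivatives are
controlled by `D^{n+j} g`, and `‖Dⁿ g(x)‖ ≤ ∑_σ ‖Dⁿ g(x)(e_σ)‖`. [folklore] -/
theorem isSmoothL2Field_of_sobolev {F : Type} [NormedAddCommGroup F] [InnerProductSpace ℝ F] [FiniteDimensional ℝ F]
    {g : ℝ3 → F} (hg : ContDiff ℝ (⊤ : ℕ∞) g) (hS : ∀ n : ℕ, ∫⁻ x, ‖iteratedFDeriv ℝ n g x‖ₑ ^ 2 < ∞) :
    IsSmoothL2Field g := by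
  haveI : CompleteSpace F := FiniteDimensional.complete ℝ F
  refine ⟨⟨hg, fun n => ?_⟩, hS⟩
  set e := stdOrthonormalBasis ℝ ℝ3
  obtain ⟨K, hK, hbound⟩ := FunctionSpaces.exists_enorm_le_sobolev_two_two_dim_three
    (E := ℝ3) (F := F) (volume : Measure ℝ3) finrank_euclideanSpace_fin
  have hG : ∀ m : ℕ, ContDiff ℝ m (iteratedFDeriv ℝ n g) := fun m =>
    hg.iteratedFDeriv_right (i := n) (m := m) (by exact_mod_cast le_top)
  -- each component is bounded
  have hcomp : ∀ σ : Fin n → Fin (Module.finrank ℝ ℝ3), ∃ R : ℝ, ∀ x, ‖iteratedFDeriv ℝ n g x (fun i => e (σ i))‖ ≤ R := by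
    intro σ
    set A : (ℝ3 [×n]→L[ℝ] F) →L[ℝ] F := ContinuousMultilinearMap.apply ℝ (fun _ : Fin n => ℝ3) F (fun i => e (σ i)) with hA
    have hgσ : ContDiff ℝ 2 (A ∘ iteratedFDeriv ℝ n g) := A.contDiff.comp (hG 2)
    set R : ℝ≥0∞ := K * ∑ j ∈ Finset.range 3, eLpNorm (iteratedFDeriv ℝ j (A ∘ iteratedFDeriv ℝ n g)) 2 volume with hR
    have hfin : ∀ j, eLpNorm (iteratedFDeriv ℝ j (A ∘ iteratedFDeriv ℝ n g)) 2 volume < ∞ := by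
      intro j
      have hle : ∀ x, ‖iteratedFDeriv ℝ j (A ∘ iteratedFDeriv ℝ n g) x‖ ≤ ‖A‖ * ‖iteratedFDeriv ℝ (n + j) g x‖ := by
        intro x
        rw [← norm_iteratedFDeriv_iteratedFDeriv n j x]
        exact A.norm_iteratedFDeriv_comp_left ((hG j).contDiffAt) le_rfl
      have h1 : eLpNorm (iteratedFDeriv ℝ j (A ∘ iteratedFDeriv ℝ n g)) 2 volume ≤
          ‖A‖₊ • eLpNorm (iteratedFDeriv ℝ (n + j) g) 2 volume :=
        eLpNorm_le_nnreal_smul_eLpNorm_of_ae_le_mul (Eventually.of_forall hle) 2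
      refine h1.trans_lt ?_
      rw [ENNReal.smul_def, smul_eq_mul]
      exact ENNReal.mul_lt_top ENNReal.coe_lt_top
        (Literature.Analysis.FunctionSpaces.lintegral_enorm_sq_lt_top_iff.1 (hS (n + j)))
    have hRtop : R ≠ ∞ := ENNReal.mul_ne_top hK.ne (ENNReal.sum_ne_top.2 fun j _ => (hfin j).ne)
    refine ⟨R.toReal, fun x => ?_⟩
    have h1 : ‖(A ∘ iteratedFDeriv ℝ n g) x‖ₑ ≤ R := hbound _ hgσ x
    rw [← ofReal_norm] at h1
    have h2 := (ENNReal.ofReal_le_iff_le_toReal hRtop).1 h1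
    simpa [hA] using h2
  choose R hR using hcomp
  refine ⟨∑ σ, R σ, fun x => ?_⟩
  exact ((iteratedFDeriv ℝ n g x).norm_le_sum_norm_apply_basis e).trans (Finset.sum_le_sum fun σ _ => hR σ x)

/-- `∫⁻ ‖D⁰ f‖ₑ² = ∫⁻ ‖f‖ₑ²`. [folklore] -/
theorem lintegral_iteratedFDeriv_zero_sq {X F : Type*} [NormedAddCommGroup X] [NormedSpace ℝ X] [MeasurableSpace X]
    [NormedAddCommGroup F] [NormedSpace ℝ F] (f : X → F) (μ : Measure X) :
    ∫⁻ x, ‖iteratedFDeriv ℝ 0 f x‖ₑ ^ 2 ∂μ = ∫⁻ x, ‖f x‖ₑ ^ 2 ∂μ := by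
  refine lintegral_congr fun x => ?_
  rw [← ofReal_norm, norm_iteratedFDeriv_zero, ofReal_norm]

variable {ν δ : ℝ} {v : ℝ → ℝ3 → ℝ3} {p : ℝ → ℝ3 → ℝ}

/-- **A compact sub-slab of a regular solution is a smooth slab solution.** Let `(v, p)` be a
classical solution of the unforced system on `(0, δ]` whose velocity has, on `[a, δ]`, bounded
derivatives of all orders, bounded Sobolev norms of all orders together with its time derivative,
and whose pressure has bounded Sobolev norms of all orders (the clauses of
`LerayLocalRegularH1With`; Ożański–Pooley 2018, Cor. 6.16). Then for `0 < a < b ≤ δ`, `(v, p)`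
is a smooth slab solution on `[a, b]` (`IsSmoothSlabSolution`). [folklore] -/
theorem isSmoothSlabSolution_of_regular (hns : IsClassicalNSSolutionOn (Ioc 0 δ) ν 0 v p) {a b : ℝ}
    (ha : 0 < a) (hab : a < b) (hb : b ≤ δ)
    (hSob : HasBoundedSobolevNormsOn (Icc a δ) v)
    (hSobdt : HasBoundedSobolevNormsOn (Icc a δ) (timeDerivWithin (Ioc 0 δ) v))
    (hsup : ∀ n : ℕ, ∃ C : ℝ, ∀ t ∈ Icc a δ, ∀ x, ‖iteratedFDeriv ℝ n (v t) x‖ ≤ C)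
    (hp : ∀ n : ℕ, ∃ C : ℝ≥0, ∀ t ∈ Icc a δ, ∫⁻ x, ‖iteratedFDeriv ℝ n (p t) x‖ₑ ^ 2 ≤ C) :
    IsSmoothSlabSolution a b ν v p := by
  have hsub : Icc a b ⊆ Ioc 0 δ := fun t ht => ⟨ha.trans_le ht.1, ht.2.trans hb⟩
  have hsub' : Icc a b ⊆ Icc a δ := Icc_subset_Icc le_rfl hb
  have hU : UniqueDiffOn ℝ (Icc a b) := uniqueDiffOn_Icc hab
  have hns' : IsClassicalNSSolutionOn (Icc a b) ν 0 v p := hns.mono hsub hU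
  -- the time derivative within `[a, b]` is the one within `(0, δ]`
  have hdt : ∀ t ∈ Icc a b, timeDerivWithin (Icc a b) v t = timeDerivWithin (Ioc 0 δ) v t := fun t ht =>
    funext fun x => hns.smooth_velocity.timeDerivWithin_eq_of_subset hsub hU ht x
  -- the time derivative is smooth in `x` with bounded Sobolev norms, hence bounded (Sobolev imbedding)
  have hwsm : IsSmoothSpaceTimeOn (Ioc 0 δ) (timeDerivWithin (Ioc 0 δ) v) :=
    hns.smooth_velocity.timeDerivWithin (uniqueDiffOn_Ioc 0 δ)
  obtain ⟨Cdt, hCdt⟩ := linfty_bound_of_hasBoundedSobolevNormsOn_holds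
    (fun t ht => (hwsm.contDiff_slice ⟨ha.trans_le ht.1, ht.2⟩).of_le (WithTop.coe_le_coe.2 le_top)) hSobdt
  refine ⟨hns', ⟨hns'.smooth_velocity, ?_, ?_, ?_, ?_⟩, fun t ht => ?_, fun t ht => ?_⟩
  · obtain ⟨C, hC⟩ := hsup 0
    exact ⟨C, fun t ht x => by simpa [norm_iteratedFDeriv_zero] using hC t (hsub' ht) x⟩
  · exact ⟨Cdt, fun t ht x => by rw [hdt t ht]; exact hCdt t (hsub' ht) x⟩
  · obtain ⟨C, hC⟩ := hSob 0
    exact ⟨C, fun t ht => by rw [← lintegral_iteratedFDeriv_zero_sq]; exact hC t (hsub' ht)⟩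
  · obtain ⟨C, hC⟩ := hSobdt 0
    exact ⟨C, fun t ht => by rw [hdt t ht, ← lintegral_iteratedFDeriv_zero_sq]; exact hC t (hsub' ht)⟩
  · -- velocity slices
    refine ⟨⟨hns'.contDiff_velocity ht, fun n => ?_⟩, fun n => ?_⟩
    · obtain ⟨C, hC⟩ := hsup n
      exact ⟨C, hC t (hsub' ht)⟩
    · obtain ⟨C, hC⟩ := hSob n
      exact (hC t (hsub' ht)).trans_lt ENNReal.coe_lt_top
  · -- pressure slices
    refine isSmoothL2Field_of_sobolev (hns'.contDiff_pressure ht) fun n => ?_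
    obtain ⟨C, hC⟩ := hp n
    exact (hC t (hsub' ht)).trans_lt ENNReal.coe_lt_top

/-- **Uniform data of a regular slab**: bounds `S₁ ≥ ∑_i ‖∂_i v(τ)‖²₂` and `S₃ ≥ T₃(v(τ))` on
`[a, b]` from the bounded Sobolev norms (`‖∂_e w‖ ≤ ‖Dw‖` for unit `e`). [folklore] -/
theorem exists_gradSq_thirdSum_le {a b : ℝ} (hSob : HasBoundedSobolevNormsOn (Icc a b) v)
    (hsm : ∀ t ∈ Icc a b, IsSmoothL2Field (v t)) :
    ∃ S₁ S₃ : ℝ≥0, ∀ t ∈ Icc a b, gradSq (v t) ≤ S₁ ∧ thirdSum (v t) ≤ S₃ := by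
  set e := stdOrthonormalBasis ℝ ℝ3 with he
  have he1 : ∀ i, ‖e i‖ = 1 := fun i => e.orthonormal.1 i
  -- first derivatives against `D¹`
  have h1 : ∀ t ∈ Icc a b, ∀ i, eLpNorm (fun x => fderiv ℝ (v t) x (e i)) 2 volume ^ 2 ≤
      ∫⁻ x, ‖iteratedFDeriv ℝ 1 (v t) x‖ₑ ^ 2 := by
    intro t ht i
    rw [Literature.Analysis.FunctionSpaces.eLpNorm_two_sq_eq_lintegral]
    refine lintegral_mono fun x => ?_
    gcongr
    rw [← ofReal_norm, ← ofReal_norm, ← norm_iteratedFDeriv_fderiv, norm_iteratedFDeriv_zero]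
    refine ENNReal.ofReal_le_ofReal ?_
    calc ‖fderiv ℝ (v t) x (e i)‖ ≤ ‖fderiv ℝ (v t) x‖ * ‖e i‖ := ContinuousLinearMap.le_opNorm _ _
      _ = ‖fderiv ℝ (v t) x‖ := by rw [he1, mul_one]
  -- third derivatives against `D³`
  have h3 : ∀ t ∈ Icc a b, ∀ i k m, eLpNorm (fun x => fderiv ℝ (fun z => fderiv ℝ (fun y => fderiv ℝ (v t) y (e i)) z (e k)) x
      (e m)) 2 volume ^ 2 ≤ ∫⁻ x, ‖iteratedFDeriv ℝ 3 (v t) x‖ₑ ^ 2 := by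
    intro t ht i k m
    have hv := hsm t ht
    set A : (ℝ3 [×2]→L[ℝ] ℝ3) →L[ℝ] ℝ3 := ContinuousMultilinearMap.apply ℝ (fun _ : Fin 2 => ℝ3) ℝ3 ![e k, e i] with hA
    -- (p1) the second partial derivative as the evaluated second derivative
    have hp1 : (fun z => fderiv ℝ (fun y => fderiv ℝ (v t) y (e i)) z (e k)) = fun z => A (iteratedFDeriv ℝ 2 (v t) z) := by
      funext z
      simp only [hA, ContinuousMultilinearMap.apply_apply, iteratedFDeriv_two_apply]
      have hdiff : DifferentiableAt ℝ (fderiv ℝ (v t)) z :=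
        ((hv.contDiff_nat 2).fderiv_right (m := 1) (by norm_num)).differentiable one_ne_zero z
      rw [fderiv_clm_apply hdiff (differentiableAt_const _)]
      simp
    -- (p2) its derivative
    have hD2 : Differentiable ℝ (iteratedFDeriv ℝ 2 (v t)) :=
      ((hv.contDiff_nat 3).differentiable_iteratedFDeriv (m := 2) (mod_cast Nat.lt_succ_self 2))
    have hp2 : ∀ x, fderiv ℝ (fun z => fderiv ℝ (fun y => fderiv ℝ (v t) y (e i)) z (e k)) x = A.comp (fderiv ℝ (iteratedFDeriv ℝ 2 (v t)) x) := by
      intro x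
      rw [hp1]
      exact (A.hasFDerivAt.comp x (hD2 x).hasFDerivAt).fderiv
    -- (p3) pointwise bound
    have hA1 : ‖A‖ ≤ 1 := by
      refine ContinuousLinearMap.opNorm_le_bound _ zero_le_one fun M => ?_
      simp only [hA, ContinuousMultilinearMap.apply_apply, one_mul]
      refine (M.le_opNorm _).trans ?_
      rw [Fin.prod_univ_two]
      simp [he1]
    have hpt : ∀ x, ‖fderiv ℝ (fun z => fderiv ℝ (fun y => fderiv ℝ (v t) y (e i)) z (e k)) x (e m)‖ ≤
        ‖iteratedFDeriv ℝ 3 (v t) x‖ := by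
      intro x
      rw [hp2 x, ContinuousLinearMap.coe_comp, Function.comp_apply, ← norm_fderiv_iteratedFDeriv]
      calc ‖A (fderiv ℝ (iteratedFDeriv ℝ 2 (v t)) x (e m))‖ ≤ ‖A‖ * ‖fderiv ℝ (iteratedFDeriv ℝ 2 (v t)) x (e m)‖ :=
            A.le_opNorm _
        _ ≤ 1 * (‖fderiv ℝ (iteratedFDeriv ℝ 2 (v t)) x‖ * ‖e m‖) := by
            gcongr; exact ContinuousLinearMap.le_opNorm _ _
        _ = ‖fderiv ℝ (iteratedFDeriv ℝ 2 (v t)) x‖ := by rw [he1, mul_one, one_mul]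
    rw [Literature.Analysis.FunctionSpaces.eLpNorm_two_sq_eq_lintegral]
    refine lintegral_mono fun x => ?_
    gcongr
    rw [← ofReal_norm, ← ofReal_norm]
    exact ENNReal.ofReal_le_ofReal (hpt x)
  obtain ⟨C₁, hC₁⟩ := hSob 1
  obtain ⟨C₃, hC₃⟩ := hSob 3
  refine ⟨3 * C₁, 27 * C₃ ^ (1 / 2 : ℝ), fun t ht => ⟨?_, ?_⟩⟩
  · unfold gradSq
    calc ∑ i, eLpNorm (fun x => fderiv ℝ (v t) x (e i)) 2 volume ^ 2
        ≤ ∑ _i : Fin (Module.finrank ℝ ℝ3), (C₁ : ℝ≥0∞) := Finset.sum_le_sum fun i _ => (h1 t ht i).trans (hC₁ t ht)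
      _ = 3 * C₁ := by
          rw [Finset.sum_const, Finset.card_univ, Fintype.card_fin, finrank_euclideanSpace_fin, nsmul_eq_mul]
          push_cast; ring
  · unfold thirdSum
    have hterm : ∀ i k m, eLpNorm (fun x => fderiv ℝ (fun z => fderiv ℝ (fun y => fderiv ℝ (v t) y (e i)) z (e k)) x
        (e m)) 2 volume ≤ ((C₃ ^ (1 / 2 : ℝ) : ℝ≥0) : ℝ≥0∞) := by
      intro i k m
      have h := (h3 t ht i k m).trans (hC₃ t ht)
      have h' : eLpNorm (fun x => fderiv ℝ (fun z => fderiv ℝ (fun y => fderiv ℝ (v t) y (e i)) z (e k)) x (e m)) 2 volume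
          ≤ ((C₃ : ℝ≥0∞)) ^ (1 / 2 : ℝ) := by
        calc _ = (eLpNorm (fun x => fderiv ℝ (fun z => fderiv ℝ (fun y => fderiv ℝ (v t) y (e i)) z (e k)) x (e m)) 2 volume ^ 2)
              ^ (1 / 2 : ℝ) := by rw [← ENNReal.rpow_natCast, ← ENNReal.rpow_mul]; norm_num
          _ ≤ _ := ENNReal.rpow_le_rpow h (by norm_num)
      refine h'.trans_eq ?_
      rw [ENNReal.coe_rpow_of_nonneg _ (by norm_num)]
    calc ∑ i, ∑ k, ∑ m, eLpNorm (fun x => fderiv ℝ (fun z => fderiv ℝ (fun y => fderiv ℝ (v t) y (e i)) z (e k)) x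
          (e m)) 2 volume
        ≤ ∑ _i : Fin (Module.finrank ℝ ℝ3), ∑ _k : Fin (Module.finrank ℝ ℝ3), ∑ _m : Fin (Module.finrank ℝ ℝ3),
            (((C₃ ^ (1 / 2 : ℝ) : ℝ≥0) : ℝ≥0∞)) := by gcongr with i _ k _ m; exact hterm i k m
      _ = 27 * ((C₃ ^ (1 / 2 : ℝ) : ℝ≥0) : ℝ≥0∞) := by
          simp only [Finset.sum_const, Finset.card_univ, Fintype.card_fin, finrank_euclideanSpace_fin, nsmul_eq_mul]
          push_cast; ring

end SlabBuild

end Literature.Analysis.FluidPDE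

namespace Literature.Analysis.FluidPDE

/-! ## Two-point inequalities: restriction, chaining, Gronwall -/

section TwoPoint

/-- The two-point inequality with a supremum on `[a, b]`:
`f(t) ≤ f(s) + (t - s)(G + K sup_{[s,t]} f)` for `a ≤ s ≤ t ≤ b`. [folklore] -/
def TwoPointOn (f : ℝ → ℝ) (G K a b : ℝ) : Prop :=
  ∀ s ∈ Icc a b, ∀ t ∈ Icc s b, f t ≤ f s + (t - s) * (G + K * sSup (f '' Icc s t))

/-- Restriction of a two-point inequality to a sub-interval. [folklore] -/
theorem TwoPointOn.mono {f : ℝ → ℝ} {G K a b a' b' : ℝ} (h : TwoPointOn f G K a b) (ha : a ≤ a') (hb : b' ≤ b) :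
    TwoPointOn f G K a' b' := fun s hs t ht => h s ⟨ha.trans hs.1, hs.2.trans hb⟩ t ⟨ht.1, ht.2.trans hb⟩

/-- **Chaining two-point inequalities over overlapping intervals**: if the inequality holds on
`[a, b]` and on `[c, d]` with `c ≤ b ≤ d`, `K ≥ 0` and `f` bounded above on `[a, d]`,
it holds on `[a, d]` (suprema over sub-intervals are dominated by the supremum over `[s, t]`). [folklore] -/
theorem TwoPointOn.chain {f : ℝ → ℝ} {G K a b c d B : ℝ} (h₁ : TwoPointOn f G K a b) (h₂ : TwoPointOn f G K c d)
    (hcb : c ≤ b) (hbd : b ≤ d) (hK : 0 ≤ K) (hB : ∀ τ ∈ Icc a d, f τ ≤ B) :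
    TwoPointOn f G K a d := by
  intro s hs t ht
  by_cases htb : t ≤ b
  · exact h₁ s ⟨hs.1, ht.1.trans htb⟩ t ⟨ht.1, htb⟩
  push Not at htb
  by_cases hsc : c ≤ s
  · exact h₂ s ⟨hsc, hs.2⟩ t ⟨ht.1, ht.2⟩
  push Not at hsc
  -- `s < c ≤ b < t`: go through `b`
  have hbdd : BddAbove (f '' Icc s t) := ⟨B, by rintro _ ⟨τ, hτ, rfl⟩; exact hB τ ⟨hs.1.trans hτ.1, hτ.2.trans ht.2⟩⟩
  have hsup1 : sSup (f '' Icc s b) ≤ sSup (f '' Icc s t) :=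
    csSup_le_csSup hbdd ⟨f s, s, ⟨le_rfl, hsc.le.trans hcb⟩, rfl⟩ (image_mono (Icc_subset_Icc le_rfl htb.le))
  have hsup2 : sSup (f '' Icc b t) ≤ sSup (f '' Icc s t) :=
    csSup_le_csSup hbdd ⟨f b, b, ⟨le_rfl, htb.le⟩, rfl⟩ (image_mono (Icc_subset_Icc (hsc.le.trans hcb) le_rfl))
  have e1 := h₁ s ⟨hs.1, hsc.le.trans hcb⟩ b ⟨hsc.le.trans hcb, le_rfl⟩
  have e2 := h₂ b ⟨hcb, hbd⟩ t ⟨htb.le, ht.2⟩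
  have hbs : 0 ≤ b - s := by linarith
  have htb' : 0 ≤ t - b := by linarith
  calc f t ≤ f b + (t - b) * (G + K * sSup (f '' Icc b t)) := e2
    _ ≤ (f s + (b - s) * (G + K * sSup (f '' Icc s b))) + (t - b) * (G + K * sSup (f '' Icc b t)) := by linarith
    _ ≤ (f s + (b - s) * (G + K * sSup (f '' Icc s t))) + (t - b) * (G + K * sSup (f '' Icc s t)) := by
        gcongr
    _ = f s + (t - s) * (G + K * sSup (f '' Icc s t)) := by ring

/-- **Gronwall from a two-point inequality** (`le_mul_exp_of_two_point_sup`, `SupGronwall.lean`):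
a nonnegative `f`, bounded above on `[a, b]` and satisfying the two-point inequality there, obeys
`f(t) ≤ (f(a) + G(t - a)) exp(2K(t - a))` for `t ∈ [a, b]`. [folklore] -/
theorem TwoPointOn.le_mul_exp {f : ℝ → ℝ} {G K a b B : ℝ} (h : TwoPointOn f G K a b) (hG : 0 ≤ G) (hK : 0 ≤ K)
    (hB : ∀ τ ∈ Icc a b, f τ ≤ B) (hf0 : ∀ τ ∈ Icc a b, 0 ≤ f τ) {t : ℝ} (ht : t ∈ Icc a b) :
    f t ≤ (f a + G * (t - a)) * Real.exp (2 * K * (t - a)) :=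
  le_mul_exp_of_two_point_sup (B := B) ht.1 hG hK (fun τ hτ => hB τ ⟨hτ.1, hτ.2.trans ht.2⟩)
    (fun τ hτ => hf0 τ ⟨hτ.1, hτ.2.trans ht.2⟩) fun s hs τ hτ => h s ⟨hs.1, hs.2.trans ht.2⟩ τ ⟨hτ.1, hτ.2.trans ht.2⟩

end TwoPoint

end Literature.Analysis.FluidPDE

namespace Literature.Analysis.FluidPDE

/-! ## One piece: the regular solution issued from a good time -/

section Piece

open LPBounds

local notation "ℝ3" => EuclideanSpace ℝ (Fin 3)

variable {ν T : ℝ} {u₀ : ℝ3 → ℝ3} {u : ℝ → ℝ3 → ℝ3}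

/-- Slices of a regular solution are smooth `L²` fields (clauses of `LerayLocalRegularH1With`). [folklore] -/
theorem isSmoothL2Field_slice_of_regular {δ : ℝ} {v : ℝ → ℝ3 → ℝ3} {p : ℝ → ℝ3 → ℝ}
    (hns : IsClassicalNSSolutionOn (Ioc 0 δ) ν 0 v p) {a : ℝ} (ha : 0 < a)
    (hSob : HasBoundedSobolevNormsOn (Icc a δ) v)
    (hsup : ∀ n : ℕ, ∃ C : ℝ, ∀ t ∈ Icc a δ, ∀ x, ‖iteratedFDeriv ℝ n (v t) x‖ ≤ C)
    {t : ℝ} (ht : t ∈ Icc a δ) : IsSmoothL2Field (v t) := by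
  refine ⟨⟨hns.contDiff_velocity ⟨ha.trans_le ht.1, ht.2⟩, fun n => ?_⟩, fun n => ?_⟩
  · obtain ⟨C, hC⟩ := hsup n
    exact ⟨C, hC t ht⟩
  · obtain ⟨C, hC⟩ := hSob n
    exact (hC t ht).trans_lt ENNReal.coe_lt_top

/-- **The piece of the argument issued from a good time.** Let `u` be a Leray–Hopf solution on
`[0, T)` (`ν > 0`) which restarts as a Leray–Hopf solution from the time `σ ∈ (0, T)`, with
`‖∇u(σ)‖²₂ ≤ A` and `A² d ≤ c₀ ν³`, `σ + d ≤ T`, and let `(v, p)` be Leray's regular solution from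
`u(σ)` on `[0, d]` (`LerayLocalRegularH1With c₀`). By weak–strong uniqueness
(`serrin_weak_strong_uniqueness_holds`, `v ∈ L^∞H¹ ⊂ L^∞L⁶`) `u(σ + τ) = v(τ)` a.e. for
`τ ∈ (0, d]`; hence the slices `u(t)`, `t ∈ (σ, σ + d]`, are a.e. smooth `L²` fields, and — if the
high blocks of `u` are small (`‖Δ̇_l u(t)‖_∞ ≤ κ 2^l`, `l ≥ J`, `t ∈ (0,T)`), `‖u(t)‖₂ ≤ E₀` and
`6 α ≤ ν` — the dyadic energy `f(t) = F(u(t)).toReal` satisfies the two-point inequality of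
`CheskidovShvydkoyApriori` on every `[σ + a', σ + b']`, `0 < a' < b' ≤ d`, `σ + b' < T`, and is
bounded there. [cite: CheskidovShvydkoy2010, Lemma 3.2 (proof)] -/
theorem piece (K : LPBounds (Fin 3)) (hν : 0 < ν) (hLH : IsLerayHopfOn T ν 0 u₀ u)
    {c₀ : ℝ} (hreg : LerayLocalRegularH1With c₀) {J : ℤ} {κ E₀ ε₁ ε₂ : ℝ≥0}
    (hblock : ∀ τ ∈ Ioo 0 T, ∀ l, J ≤ l → blockSup (u τ) l ≤ κ * 2 ^ l)
    (hE₀ : ∀ τ ∈ Icc 0 T, eLpNorm (u τ) 2 volume ≤ E₀) (hε₁ : ε₁ ≠ 0) (hε₂ : ε₂ ≠ 0)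
    (hsmall : 2 * Fintype.card (Fin 3) * K.cAlpha J κ E₀ ε₁ ε₂ ≤ ENNReal.ofReal ν)
    {σ : ℝ} (hσ : σ ∈ Ioo 0 T) (hLHσ : IsLerayHopfOn (T - σ) ν 0 (u σ) (fun t => u (t + σ)))
    {A d : ℝ} (hA : 0 ≤ A) (hAσ : eWeakGradL2Sq (u σ) ≤ ENNReal.ofReal A) (hd : 0 < d) (hσd : σ + d ≤ T)
    (hAd : A ^ 2 * d ≤ c₀ * ν ^ 3) :
    (∀ τ ∈ Ioc σ (σ + d), ∃ w : ℝ3 → ℝ3, IsSmoothL2Field w ∧ u τ =ᵐ[volume] w) ∧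
    (∀ a' b' : ℝ, 0 < a' → a' < b' → b' ≤ d → σ + b' < T →
      TwoPointOn (fun τ => (dyadicF (u τ)).toReal) (2 * (K.cG J E₀ ε₂).toReal) (2 * (K.cK J E₀ ε₁).toReal)
        (σ + a') (σ + b') ∧
      ∃ B : ℝ, ∀ τ ∈ Icc (σ + a') (σ + b'), (dyadicF (u τ)).toReal ≤ B) := by
  have hu2 : MemLp (u σ) 2 volume := hLH.memLp σ ⟨hσ.1.le, hσ.2.le⟩
  have hdiv : IsWeaklyDivFree (u σ) := hLHσ.isWeaklyDivFree_datum (sub_pos.2 hσ.2)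
  obtain ⟨v, p, hv, hv0, hvreg, hns, hcl⟩ := hreg hν hd hu2 hdiv hA hAσ hAd
  -- weak–strong uniqueness on `(0, d]`
  have hLHσ' : IsLerayHopfOn d ν 0 (u σ) (fun t => u (t + σ)) := hLHσ.of_le (by linarith)
  have hS : MemLqLp ∞ 6 v (Ioo 0 d) :=
    memLqLp_top_six_of_isH1RegularOn_Icc hvreg fun t ht => hv.memLp t ht
  have hqr : 2 / (∞ : ℝ≥0∞) + 3 / 6 ≤ 1 := by
    rw [ENNReal.div_top, zero_add]
    exact ENNReal.div_le_of_le_mul (by norm_num)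
  have hae : ∀ t ∈ Ioc 0 d, u (t + σ) =ᵐ[volume] v t := fun t ht =>
    serrin_weak_strong_uniqueness_holds hν hd hv hu2 (q := ∞) (r := 6) (by norm_num) hqr hS hLHσ' t ht
  have hae' : ∀ τ ∈ Ioc σ (σ + d), u τ =ᵐ[volume] v (τ - σ) := by
    intro τ hτ
    have h := hae (τ - σ) ⟨sub_pos.2 hτ.1, by linarith [hτ.2]⟩
    rwa [sub_add_cancel] at h
  refine ⟨fun τ hτ => ?_, fun a' b' ha' hab' hb'd hσb' => ?_⟩
  · -- a.e. smooth representatives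
    obtain ⟨hSob, -, hsup, -⟩ := hcl (τ - σ) (sub_pos.2 hτ.1) (by linarith [hτ.2])
    exact ⟨v (τ - σ), isSmoothL2Field_slice_of_regular hns (sub_pos.2 hτ.1) hSob hsup
      ⟨le_rfl, by linarith [hτ.2]⟩, hae' τ hτ⟩
  · -- the slab `[a', b']` of `v`
    obtain ⟨hSob, hSobdt, hsup, hp⟩ := hcl a' ha' (hab'.le.trans hb'd)
    have hslab : IsSmoothSlabSolution a' b' ν v p := isSmoothSlabSolution_of_regular hns ha' hab' hb'd hSob hSobdt hsup hp
    obtain ⟨S₁, S₃, hS⟩ := exists_gradSq_thirdSum_le (v := v) (hSob.mono (Icc_subset_Icc le_rfl hb'd)) hslab.smooth_slice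
    -- hypotheses of the a-priori estimate along `v`
    have hmemI : ∀ t ∈ Icc a' b', t ∈ Ioc 0 d := fun t ht => ⟨ha'.trans_le ht.1, ht.2.trans hb'd⟩
    have hsv : ∀ t ∈ Icc a' b', ∀ l, J ≤ l → blockSup (v t) l ≤ κ * 2 ^ l := by
      intro t ht l hl
      rw [← blockSup_congr_ae (hae t (hmemI t ht))]
      exact hblock (t + σ) ⟨by linarith [ht.1, hσ.1], by linarith [ht.2]⟩ l hl
    have hEv : ∀ t ∈ Icc a' b', eLpNorm (v t) 2 volume ≤ E₀ := by
      intro t ht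
      rw [← eLpNorm_congr_ae (hae t (hmemI t ht))]
      exact hE₀ (t + σ) ⟨by linarith [ht.1, hσ.1], by linarith [ht.2]⟩
    have h2p := fun (s : ℝ) (hs : s ∈ Icc a' b') (t : ℝ) (ht : t ∈ Icc s b') =>
      hslab.dyadicF_two_point K hν.le (J := J) (κ := κ) (E₀ := E₀) (S₁ := S₁) (S₃ := S₃) (ε₁ := ε₁) (ε₂ := ε₂)
        hsv hEv (fun τ hτ => (hS τ hτ).1) (fun τ hτ => (hS τ hτ).2) hε₁ hε₂ hsmall hs.1 ht.1 ht.2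
    -- translate to `u`
    have hfeq : ∀ t ∈ Icc a' b', (dyadicF (u (t + σ))).toReal = (dyadicF (v t)).toReal := fun t ht => by
      rw [dyadicF_congr_ae (hae t (hmemI t ht))]
    have himg : ∀ s t, a' ≤ s → t ≤ b' →
        (fun τ => (dyadicF (u τ)).toReal) '' Icc (σ + s) (σ + t) = (fun τ => (dyadicF (v τ)).toReal) '' Icc s t := by
      intro s t hs ht
      ext y
      constructor
      · rintro ⟨τ, hτ, rfl⟩
        refine ⟨τ - σ, ⟨by linarith [hτ.1], by linarith [hτ.2]⟩, ?_⟩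
        simp only
        rcases le_or_gt s t with hst | hst
        · rw [← hfeq (τ - σ) ⟨by linarith [hτ.1], by linarith [hτ.2]⟩, sub_add_cancel]
        · exact absurd (hτ.1.trans hτ.2) (by linarith)
      · rintro ⟨τ, hτ, rfl⟩
        refine ⟨τ + σ, ⟨by linarith [hτ.1], by linarith [hτ.2]⟩, ?_⟩
        simp only
        rcases le_or_gt s t with hst | hst
        · exact hfeq τ ⟨hs.trans hτ.1, hτ.2.trans ht⟩
        · exact absurd (hτ.1.trans hτ.2) (by linarith)
    refine ⟨fun s hs t ht => ?_, ?_⟩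
    · have hs' : s - σ ∈ Icc a' b' := ⟨by linarith [hs.1], by linarith [hs.2]⟩
      have ht' : t - σ ∈ Icc (s - σ) b' := ⟨by linarith [ht.1], by linarith [ht.2]⟩
      have key := h2p (s - σ) hs' (t - σ) ht'
      have e1 := hfeq (s - σ) hs'
      have e2 := hfeq (t - σ) ⟨hs'.1.trans ht'.1, ht'.2⟩
      rw [sub_add_cancel] at e1 e2
      simp only
      rw [e1, e2]
      have hi := himg (s - σ) (t - σ) hs'.1 ht'.2
      rw [add_sub_cancel, add_sub_cancel] at hi
      rw [hi]
      convert key using 2; ring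
    · refine ⟨(8 * (Fintype.card (Fin 3) * ((K.Cr : ℝ≥0∞) ^ 2 * S₁))).toReal, fun τ hτ => ?_⟩
      have hτ' : τ - σ ∈ Icc a' b' := ⟨by linarith [hτ.1], by linarith [hτ.2]⟩
      have e1 := hfeq (τ - σ) hτ'
      rw [sub_add_cancel] at e1
      rw [e1]
      exact ENNReal.toReal_mono (ENNReal.mul_ne_top (by norm_num) (ENNReal.mul_ne_top (ENNReal.natCast_ne_top _)
        (ENNReal.mul_ne_top (ENNReal.pow_ne_top ENNReal.coe_ne_top) ENNReal.coe_ne_top)))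
        (dyadicF_le_of_gradSq_le K (hslab.smooth_slice _ hτ') (hS _ hτ').1)

end Piece

end Literature.Analysis.FluidPDE

namespace Literature.Analysis.FluidPDE

/-! ## The bootstrap along an interval of regularity -/

section Bootstrap

open LPBounds

local notation "ℝ3" => EuclideanSpace ℝ (Fin 3)

variable {ν T : ℝ} {u₀ : ℝ3 → ℝ3} {u : ℝ → ℝ3 → ℝ3}

/-- A uniform `L²` bound for the slices of an unforced Leray–Hopf solution (energy inequality from
`0`; Leray 1934, (5.2)). [folklore] -/
theorem exists_eLpNorm_slice_le (hLH : IsLerayHopfOn T ν 0 u₀ u) (hν : 0 ≤ ν) :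
    ∃ E₀ : ℝ≥0, ∀ t ∈ Icc 0 T, eLpNorm (u t) 2 volume ≤ E₀ := by
  obtain ⟨G, -, -, hE, -⟩ := hLH.weakGrad_energy
  set k₀ := VectorCalculus.kineticEnergy u₀
  refine ⟨((ENNReal.ofReal (2 * k₀)) ^ (1 / 2 : ℝ)).toNNReal, fun t ht => ?_⟩
  have h1 := hE t ht
  simp only [Pi.zero_apply, inner_zero_left, integral_zero, intervalIntegral.integral_zero, add_zero] at h1
  have hK : VectorCalculus.kineticEnergy (u t) ≤ k₀ :=
    le_trans (le_add_of_nonneg_right (mul_nonneg hν ENNReal.toReal_nonneg)) h1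
  have h2 : eLpNorm (u t) 2 volume ^ 2 ≤ ENNReal.ofReal (2 * k₀) := by
    rw [← eEnergy_eq_eLpNorm_sq, eEnergy_eq_ofReal _ (hLH.memLp t ht)]
    exact ENNReal.ofReal_le_ofReal (by linarith)
  rw [ENNReal.coe_toNNReal (ENNReal.rpow_ne_top_of_nonneg (by norm_num) ENNReal.ofReal_ne_top)]
  calc eLpNorm (u t) 2 volume = (eLpNorm (u t) 2 volume ^ 2) ^ (1 / 2 : ℝ) := by
        rw [← ENNReal.rpow_natCast, ← ENNReal.rpow_mul]; norm_num
    _ ≤ (ENNReal.ofReal (2 * k₀)) ^ (1 / 2 : ℝ) := ENNReal.rpow_le_rpow h2 (by norm_num)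

/-- The weak dissipation of an a.e. smooth slice is controlled by its dyadic energy:
`‖∇u(σ)‖²₂ ≤ 2 C_b² d F(u(σ))`. [folklore] -/
theorem eWeakGradL2Sq_le_of_rep (K : LPBounds (Fin 3)) {uσ w : ℝ3 → ℝ3} (hw : IsSmoothL2Field w)
    (hae : uσ =ᵐ[volume] w) :
    eWeakGradL2Sq uσ ≤ 2 * ((K.Cb : ℝ≥0∞) ^ 2 * (Fintype.card (Fin 3) * dyadicF uσ)) := by
  rw [eWeakGradL2Sq_congr_ae hae, ← gradSq_eq_eWeakGradL2Sq hw, dyadicF_congr_ae hae]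
  exact K.gradSq_le_dyadicF hw

/-- The dyadic energy of an a.e. smooth slice is finite. [folklore] -/
theorem dyadicF_ne_top_of_rep (K : LPBounds (Fin 3)) {uσ w : ℝ3 → ℝ3} (hw : IsSmoothL2Field w)
    (hae : uσ =ᵐ[volume] w) : dyadicF uσ ≠ ∞ := by
  rw [dyadicF_congr_ae hae]
  refine ne_top_of_le_ne_top ?_ (K.dyadicF_le_gradSq hw)
  refine ENNReal.mul_ne_top (by norm_num) (ENNReal.mul_ne_top (ENNReal.natCast_ne_top _)
    (ENNReal.mul_ne_top (ENNReal.pow_ne_top ENNReal.coe_ne_top) ?_))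
  unfold gradSq
  exact ENNReal.sum_ne_top.2 fun i _ => ENNReal.pow_ne_top (hw.memLp_fderiv_apply _).eLpNorm_ne_top

-- Budget: this proof measures ≈ 201 000 heartbeats when elaborated synchronously (`set_option Elab.async false`
-- + `#count_heartbeats in`), i.e. just above the default 200 000: `lake build` failed deterministically at the
-- last `exact` (827:42, whnf timeout) from 03:55Z to 04:52Z on 2026-08-15 while the asynchronous `lean` CLI
-- elaboration used by the gate passed. Doubling the budget is the standard remedy (proof text unchanged).
set_option maxHeartbeats 400000 in
/-- **The bootstrap** (Cheskidov–Shvydkoy 2010, proof of Lemma 3.2 with Thm. 2.4: the `H¹` norm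
stays bounded up to the right end of an interval of regularity). Let `u` be Leray–Hopf on `[0,T)`,
`ν > 0`, with Leray's regular local solutions available (`LerayLocalRegularH1With c₀`), small high
blocks (`‖Δ̇_l u(t)‖_∞ ≤ κ 2^l`, `l ≥ J`, `t ∈ (0,T)`), `‖u(t)‖₂ ≤ E₀` and `6 α ≤ ν`. If `u` is
`H¹`-regular on `(α, β) ⊂ (0, T)`, then `‖u(t)‖²_{H¹}` is bounded on a left neighbourhood of `β`.
Mechanism: from a good time `s₀` the regular solution gives a first piece; with
`F^* = (f(s₁) + G(β - s₁)) e^{2K(β - s₁)}` and the uniform lifespan `δ` attached to the enstrophy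
bound `2 C_b² d F^*`, one restarts at good times `σ ∈ (b - δ/8, b)` inside the region already covered,
the new piece `[(σ+b)/2, min(σ+δ, β')]` overlaps the old one, the two-point inequalities chain
(`TwoPointOn.chain`) and Gronwall (`TwoPointOn.le_mul_exp`) keeps `f ≤ F^*`; after finitely many
steps `[s₁, β']` is covered for every `β' < β`. [cite: CheskidovShvydkoy2010, Lemma 3.2 (proof)] -/
theorem exists_eH1NormSq_le_of_isH1RegularOn (K : LPBounds (Fin 3)) (hν : 0 < ν) (hLH : IsLerayHopfOn T ν 0 u₀ u)
    {c₀ : ℝ} (hc₀ : 0 < c₀) (hreg : LerayLocalRegularH1With c₀) {J : ℤ} {κ E₀ ε₁ ε₂ : ℝ≥0}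
    (hblock : ∀ τ ∈ Ioo 0 T, ∀ l, J ≤ l → blockSup (u τ) l ≤ κ * 2 ^ l)
    (hE₀ : ∀ τ ∈ Icc 0 T, eLpNorm (u τ) 2 volume ≤ E₀) (hε₁ : ε₁ ≠ 0) (hε₂ : ε₂ ≠ 0)
    (hsmall : 2 * Fintype.card (Fin 3) * K.cAlpha J κ E₀ ε₁ ε₂ ≤ ENNReal.ofReal ν)
    {α β : ℝ} (hα : 0 ≤ α) (hαβ : α < β) (hβT : β ≤ T) (hregI : IsH1RegularOn (Ioo α β) u) :
    ∃ s₁ ∈ Ioo α β, ∃ M : ℝ≥0∞, M < ∞ ∧ ∀ t ∈ Ico s₁ β, eH1NormSq (u t) ≤ M := by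
  set f : ℝ → ℝ := fun τ => (dyadicF (u τ)).toReal with hf
  set G : ℝ := 2 * (K.cG J E₀ ε₂).toReal with hG
  set Kc : ℝ := 2 * (K.cK J E₀ ε₁).toReal with hKc
  have hG0 : 0 ≤ G := by positivity
  have hKc0 : 0 ≤ Kc := by positivity
  have hf0 : ∀ τ, 0 ≤ f τ := fun τ => ENNReal.toReal_nonneg
  -- the piece lemma, specialised
  have hpiece := fun (σ : ℝ) (hσ : σ ∈ Ioo 0 T) (hLHσ : IsLerayHopfOn (T - σ) ν 0 (u σ) (fun t => u (t + σ)))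
      (A d : ℝ) (hA : 0 ≤ A) (hAσ : eWeakGradL2Sq (u σ) ≤ ENNReal.ofReal A) (hd : 0 < d) (hσd : σ + d ≤ T)
      (hAd : A ^ 2 * d ≤ c₀ * ν ^ 3) =>
    piece K hν hLH hreg hblock hE₀ hε₁ hε₂ hsmall hσ hLHσ hA hAσ hd hσd hAd
  -- Step 0: a good time `s₀ ∈ (α, β)` and the first piece
  obtain ⟨s₀, hs₀, hLHs₀⟩ := hLH.exists_isLerayHopfOn_restart_Ioo hν.le hα hαβ hβT
  have hs₀T : s₀ ∈ Ioo 0 T := ⟨hα.trans_lt hs₀.1, hs₀.2.trans_le hβT⟩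
  have hfin₀ : eH1NormSq (u s₀) < ∞ := hregI.1 s₀ hs₀
  set A₀ : ℝ := (eH1NormSq (u s₀)).toReal with hA₀
  have hA₀0 : 0 ≤ A₀ := ENNReal.toReal_nonneg
  have hAs₀ : eWeakGradL2Sq (u s₀) ≤ ENNReal.ofReal A₀ := by
    rw [hA₀, ENNReal.ofReal_toReal hfin₀.ne, eH1NormSq_def]
    exact le_add_self
  set δ₀ : ℝ := min (c₀ * ν ^ 3 / (A₀ ^ 2 + 1)) (β - s₀) with hδ₀
  have hδ₀pos : 0 < δ₀ := lt_min (div_pos (by positivity) (by positivity)) (sub_pos.2 hs₀.2)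
  have hδ₀β : s₀ + δ₀ ≤ β := by linarith [min_le_right (c₀ * ν ^ 3 / (A₀ ^ 2 + 1)) (β - s₀)]
  have hAδ₀ : A₀ ^ 2 * δ₀ ≤ c₀ * ν ^ 3 := by
    calc A₀ ^ 2 * δ₀ ≤ A₀ ^ 2 * (c₀ * ν ^ 3 / (A₀ ^ 2 + 1)) := by gcongr; exact min_le_left _ _
      _ = c₀ * ν ^ 3 * (A₀ ^ 2 / (A₀ ^ 2 + 1)) := by ring
      _ ≤ c₀ * ν ^ 3 * 1 := by
          gcongr; rw [div_le_one (by positivity)]; linarith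
      _ = c₀ * ν ^ 3 := mul_one _
  obtain ⟨hrep₀, h2p₀⟩ := hpiece s₀ hs₀T hLHs₀ A₀ δ₀ hA₀0 hAs₀ hδ₀pos (hδ₀β.trans hβT) hAδ₀
  set s₁ : ℝ := s₀ + δ₀ / 2 with hs₁
  have hs₁I : s₁ ∈ Ioo α β := ⟨by linarith [hs₀.1], by linarith⟩
  -- Step 1: the uniform constants
  obtain ⟨w₁, hw₁, hae₁⟩ := hrep₀ s₁ ⟨by linarith, by linarith⟩
  have hf₁top : dyadicF (u s₁) ≠ ∞ := dyadicF_ne_top_of_rep K hw₁ hae₁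
  set Fmax : ℝ := (f s₁ + G * (β - s₁)) * Real.exp (2 * Kc * (β - s₁)) with hFmax
  have hFmax0 : 0 ≤ Fmax :=
    mul_nonneg (add_nonneg (hf0 _) (mul_nonneg hG0 (by linarith [hs₁I.2]))) (Real.exp_pos _).le
  set Bmax : ℝ := 2 * ((K.Cb : ℝ) ^ 2 * (Fintype.card (Fin 3) * Fmax)) with hBmax
  have hBmax0 : 0 ≤ Bmax := by rw [hBmax]; positivity
  set δ : ℝ := c₀ * ν ^ 3 / (Bmax ^ 2 + 1) with hδ
  have hδpos : 0 < δ := div_pos (by positivity) (by positivity)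
  have hBδ : Bmax ^ 2 * δ ≤ c₀ * ν ^ 3 := by
    calc Bmax ^ 2 * δ = c₀ * ν ^ 3 * (Bmax ^ 2 / (Bmax ^ 2 + 1)) := by rw [hδ]; ring
      _ ≤ c₀ * ν ^ 3 * 1 := by gcongr; rw [div_le_one (by positivity)]; linarith
      _ = c₀ * ν ^ 3 := mul_one _
  -- the enstrophy at a covered time is controlled by `f`
  have hgrad : ∀ σ, (∃ w : ℝ3 → ℝ3, IsSmoothL2Field w ∧ u σ =ᵐ[volume] w) → f σ ≤ Fmax →
      eWeakGradL2Sq (u σ) ≤ ENNReal.ofReal Bmax := by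
    rintro σ ⟨w, hw, hae⟩ hfσ
    have htop : dyadicF (u σ) ≠ ∞ := dyadicF_ne_top_of_rep K hw hae
    refine (eWeakGradL2Sq_le_of_rep K hw hae).trans ?_
    rw [hBmax, ENNReal.ofReal_mul (by norm_num), ENNReal.ofReal_mul (by positivity), ENNReal.ofReal_mul (by positivity),
      ENNReal.ofReal_pow (by positivity), ENNReal.ofReal_coe_nnreal, ENNReal.ofReal_ofNat, ENNReal.ofReal_natCast]
    gcongr
    rw [← ENNReal.ofReal_toReal htop]
    exact ENNReal.ofReal_le_ofReal hfσ
  -- Gronwall on a covered interval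
  have hgron : ∀ b, b ≤ β → TwoPointOn f G Kc s₁ b → (∃ B, ∀ τ ∈ Icc s₁ b, f τ ≤ B) →
      ∀ t ∈ Icc s₁ b, f t ≤ Fmax := by
    rintro b hbβ h2p ⟨B, hB⟩ t ht
    refine (h2p.le_mul_exp hG0 hKc0 hB (fun τ _ => hf0 τ) ht).trans ?_
    rw [hFmax]
    have h1 : t - s₁ ≤ β - s₁ := by linarith [ht.2]
    have h3 : 0 ≤ f s₁ + G * (β - s₁) := add_nonneg (hf0 _) (mul_nonneg hG0 (by linarith [hs₁I.2]))
    have h4 : f s₁ + G * (t - s₁) ≤ f s₁ + G * (β - s₁) := by nlinarith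
    have h5 : Real.exp (2 * Kc * (t - s₁)) ≤ Real.exp (2 * Kc * (β - s₁)) :=
      Real.exp_le_exp.2 (by nlinarith)
    exact mul_le_mul h4 h5 (Real.exp_pos _).le h3
  clear_value Fmax Bmax δ
  -- Step 2: the induction, for a fixed `β' < β`
  have hcover : ∀ β', s₁ < β' → β' < β → TwoPointOn f G Kc s₁ β' ∧ (∃ B, ∀ τ ∈ Icc s₁ β', f τ ≤ B) ∧
      (∀ τ ∈ Icc s₁ β', ∃ w : ℝ3 → ℝ3, IsSmoothL2Field w ∧ u τ =ᵐ[volume] w) := by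
    intro β' hβ'1 hβ'2
    -- `P k`: coverage up to `min (s₁ + k δ/8) β'`
    have hP : ∀ k : ℕ, ∃ b, min (s₁ + k * (δ / 8)) β' ≤ b ∧ b ≤ β' ∧ s₁ < b ∧ TwoPointOn f G Kc s₁ b ∧
        (∃ B, ∀ τ ∈ Icc s₁ b, f τ ≤ B) ∧ (∀ τ ∈ Icc s₁ b, ∃ w : ℝ3 → ℝ3, IsSmoothL2Field w ∧ u τ =ᵐ[volume] w) := by
      intro k
      induction k with
      | zero =>
        -- the first piece `[s₁, min (s₀ + δ₀) β']`
        set b := min (s₀ + δ₀) β' with hb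
        have hs₁b : s₁ < b := lt_min (by linarith) hβ'1
        have hb' : 0 < b - s₀ := by linarith
        obtain ⟨h2p, hB⟩ := h2p₀ (δ₀ / 2) (b - s₀) (by linarith) (by linarith) (by linarith [min_le_left (s₀ + δ₀) β'])
          (by linarith [min_le_right (s₀ + δ₀) β'])
        refine ⟨b, by simp [le_of_lt hs₁b], min_le_right _ _, hs₁b, ?_, ?_, fun τ hτ => hrep₀ τ ⟨by linarith [hτ.1], ?_⟩⟩
        · simpa [hs₁, add_sub_cancel] using h2p
        · obtain ⟨B, hB⟩ := hB
          exact ⟨B, fun τ hτ => hB τ (by simpa [hs₁, add_sub_cancel] using hτ)⟩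
        · linarith [hτ.2, min_le_left (s₀ + δ₀) β']
      | succ k ih =>
        obtain ⟨b, hbmin, hbβ', hs₁b, h2p, ⟨B, hB⟩, hrep⟩ := ih
        rcases eq_or_lt_of_le hbβ' with hbeq | hblt
        · refine ⟨b, ?_, hbβ', hs₁b, h2p, ⟨B, hB⟩, hrep⟩
          rw [hbeq]; exact min_le_right _ _
        -- a good time `σ ∈ (max s₁ (b - δ/8), b)`
        have hmax : max s₁ (b - δ / 8) < b := max_lt hs₁b (by linarith)
        obtain ⟨σ, hσ, hLHσ⟩ := hLH.exists_isLerayHopfOn_restart_Ioo hν.le (a := max s₁ (b - δ / 8)) (b := b)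
          (le_max_of_le_left (by linarith [hs₁I.1])) hmax (hbβ'.trans (hβ'2.le.trans hβT))
        have hσ1 : s₁ < σ := (le_max_left _ _).trans_lt hσ.1
        have hσ2 : b - δ / 8 < σ := (le_max_right _ _).trans_lt hσ.1
        have hσT : σ ∈ Ioo 0 T := ⟨by linarith [hs₁I.1, hσ1], by linarith [hβ'2, hβT, hσ.2, hbβ']⟩
        -- enstrophy bound at `σ`
        have hfσ : f σ ≤ Fmax := hgron b (hbβ'.trans hβ'2.le) h2p ⟨B, hB⟩ σ ⟨hσ1.le, hσ.2.le⟩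
        have hAσ : eWeakGradL2Sq (u σ) ≤ ENNReal.ofReal Bmax := hgrad σ (hrep σ ⟨hσ1.le, hσ.2.le⟩) hfσ
        -- the new piece
        set d := min δ (β - σ) with hd
        have hdpos : 0 < d := lt_min hδpos (by linarith [hσ.2, hbβ', hβ'2])
        have hσd : σ + d ≤ T := by linarith [min_le_right δ (β - σ)]
        have hBd : Bmax ^ 2 * d ≤ c₀ * ν ^ 3 := (mul_le_mul_of_nonneg_left (min_le_left _ _) (sq_nonneg _)).trans hBδ
        obtain ⟨hrepσ, h2pσ⟩ := hpiece σ hσT hLHσ Bmax d hBmax0 hAσ hdpos hσd hBd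
        set bp := min (σ + δ) β' with hbp
        have hbbp : b ≤ bp := le_min (by linarith) hbβ'
        have hcb : (σ + b) / 2 ≤ b := by linarith [hσ.2]
        obtain ⟨h2pnew, ⟨B', hB'⟩⟩ := h2pσ ((b - σ) / 2) (bp - σ) (by linarith [hσ.2])
          (by
            have : (σ + b) / 2 < bp := lt_min (by linarith [hσ.2]) (by linarith [hσ.2])
            linarith)
          (by
            rw [hd]
            refine le_min ?_ ?_ <;> linarith [min_le_left (σ + δ) β', min_le_right (σ + δ) β'])
          (by linarith [min_le_right (σ + δ) β'])
        have heq1 : σ + (b - σ) / 2 = (σ + b) / 2 := by ring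
        have heq2 : σ + (bp - σ) = bp := by ring
        rw [heq1, heq2] at h2pnew hB'
        -- chain
        have hBall : ∀ τ ∈ Icc s₁ bp, f τ ≤ max B B' := by
          intro τ hτ
          rcases le_or_gt τ b with hτb | hτb
          · exact (hB τ ⟨hτ.1, hτb⟩).trans (le_max_left _ _)
          · exact (hB' τ ⟨by linarith, hτ.2⟩).trans (le_max_right _ _)
        have h2p' : TwoPointOn f G Kc s₁ bp := h2p.chain h2pnew hcb hbbp hKc0 hBall
        refine ⟨bp, ?_, min_le_right _ _, hs₁b.trans_le hbbp, h2p', ⟨max B B', hBall⟩, fun τ hτ => ?_⟩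
        · -- progress
          have hkb : s₁ + k * (δ / 8) ≤ b := by
            rcases min_le_iff.1 hbmin with h | h
            · exact h
            · exact absurd h (not_le.2 hblt)
          refine min_le_min_right β' ?_
          push_cast
          linarith [hkb, hσ2]
        · rcases le_or_gt τ b with hτb | hτb
          · exact hrep τ ⟨hτ.1, hτb⟩
          · have hbpd : bp ≤ σ + d := by
              rw [hd, ← min_add_add_left, add_sub_cancel]
              exact min_le_min le_rfl hβ'2.le
            exact hrepσ τ ⟨by linarith [hσ.2], hτ.2.trans hbpd⟩
    -- take `k` large
    obtain ⟨k, hk⟩ := exists_nat_ge ((β' - s₁) / (δ / 8))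
    obtain ⟨b, hbmin, hbβ', -, h2p, hB, hrep⟩ := hP k
    have hkδ : β' ≤ s₁ + k * (δ / 8) := by
      have hδ8 : 0 < δ / 8 := by linarith
      have h1 : (β' - s₁) / (δ / 8) * (δ / 8) = β' - s₁ := div_mul_cancel₀ _ hδ8.ne'
      have h2 : (β' - s₁) / (δ / 8) * (δ / 8) ≤ k * (δ / 8) := mul_le_mul_of_nonneg_right hk hδ8.le
      linarith
    have hb : b = β' := le_antisymm hbβ' (by rw [min_eq_right hkδ] at hbmin; exact hbmin)
    subst hb
    exact ⟨h2p, hB, hrep⟩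
  -- Step 3: the bound
  refine ⟨s₁, hs₁I, (E₀ : ℝ≥0∞) ^ 2 + ENNReal.ofReal Bmax, ?_, fun t ht => ?_⟩
  · exact ENNReal.add_lt_top.2 ⟨ENNReal.pow_lt_top ENNReal.coe_lt_top, ENNReal.ofReal_lt_top⟩
  · set β' := (t + β) / 2 with hβ'
    have hβ'1 : s₁ < β' := by rw [hβ']; linarith [ht.1, ht.2]
    have hβ'2 : β' < β := by rw [hβ']; linarith [ht.2]
    have htβ' : t ∈ Icc s₁ β' := ⟨ht.1, by rw [hβ']; linarith [ht.2]⟩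
    obtain ⟨h2p, hB, hrep⟩ := hcover β' hβ'1 hβ'2
    have hft : f t ≤ Fmax := hgron β' hβ'2.le h2p hB t htβ'
    rw [eH1NormSq_def]
    refine add_le_add ?_ (hgrad t (hrep t htβ') hft)
    rw [eEnergy_eq_eLpNorm_sq]
    exact ENNReal.pow_le_pow_left (hE₀ t ⟨by linarith [hs₁I.1, ht.1], ht.2.le.trans hβT⟩)

end Bootstrap

end Literature.Analysis.FluidPDE

namespace Literature.Analysis.FluidPDE

/-! ## Cheskidov–Shvydkoy's Lemma 3.2 and Theorem 3.1 from Leray's regular local theory -/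

section Final

open LPBounds

local notation "ℝ3" => EuclideanSpace ℝ (Fin 3)

/-- An elementary real inequality used to size the Young parameters: `a b (x / (k (a+1)(b+1))) ≤ x / k`
for `a, b, x ≥ 0`, `k > 0`. [folklore] -/
theorem mul_mul_div_le {a b x k : ℝ} (ha : 0 ≤ a) (hb : 0 ≤ b) (hx : 0 ≤ x) (hk : 0 < k) :
    a * b * (x / (k * (a + 1) * (b + 1))) ≤ x / k := by
  have h1 : a * b ≤ (a + 1) * (b + 1) := by nlinarith
  have hpos : 0 < k * (a + 1) * (b + 1) := by positivity
  rw [mul_div_assoc', div_le_div_iff₀ hpos hk]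
  calc a * b * x * k = (a * b) * (x * k) := by ring
    _ ≤ ((a + 1) * (b + 1)) * (x * k) := by gcongr
    _ = x * (k * (a + 1) * (b + 1)) := by ring

/-- **From the dyadic hypothesis to the block sup bound.** If the distributions `U t` of the slices
of `u` satisfy `limsup_q sup_{t ∈ (0,T)} 2^{-q} ‖Δ̇_q U(t)‖_∞ < c ν`, then for some `J` and all
`l ≥ J`, `t ∈ (0, T)`: `‖Δ̇_l u(t)‖_∞ ≤ (c ν) 2^l` (dictionary `IsDistributionOf.lpBlockWeight_top_eq`).
[folklore] -/
theorem exists_blockSup_le_of_limsup_lt {T c ν : ℝ} {u : ℝ → ℝ3 → ℝ3}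
    {U : ℝ → TemperedDistribution ℝ3 (EuclideanSpace ℂ (Fin 3))}
    (hu : ∀ t ∈ Icc 0 T, MemLp (u t) 2 volume) (hU : ∀ t ∈ Icc 0 T, IsDistributionOf (u t) (U t))
    (hlim : limsup (fun j : ℕ => ⨆ t ∈ Ioo 0 T, FunctionSpaces.lpBlockWeight (-1) ∞ (U t) (j : ℤ)) atTop <
      ENNReal.ofReal (c * ν)) :
    ∃ J : ℤ, ∀ τ ∈ Ioo 0 T, ∀ l, J ≤ l → blockSup (u τ) l ≤ ((c * ν).toNNReal : ℝ≥0∞) * 2 ^ l := by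
  haveI : Fact (1 ≤ (2 : ℝ≥0∞)) := ⟨one_le_two⟩
  have hev := Filter.eventually_lt_of_limsup_lt hlim
  obtain ⟨J₀, hJ₀⟩ := Filter.eventually_atTop.1 hev
  refine ⟨J₀, fun τ hτ l hl => ?_⟩
  have hl0 : 0 ≤ l := le_trans (Int.natCast_nonneg J₀) hl
  have hlnat : ((l.toNat : ℕ) : ℤ) = l := Int.toNat_of_nonneg hl0
  have hj : J₀ ≤ l.toNat := by omega
  have h1 : FunctionSpaces.lpBlockWeight (-1) ∞ (U τ) l ≤ ENNReal.ofReal (c * ν) := by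
    have := hJ₀ l.toNat hj
    rw [hlnat] at this
    exact (le_iSup₂ (f := fun t (_ : t ∈ Ioo 0 T) => FunctionSpaces.lpBlockWeight (-1) ∞ (U t) l) τ hτ).trans this.le
  have hτ' : τ ∈ Icc 0 T := ⟨hτ.1.le, hτ.2.le⟩
  rw [(hU τ hτ').lpBlockWeight_top_eq (hu τ hτ') (-1) l] at h1
  have h2 : (2 : ℝ≥0∞) ^ ((l : ℝ) * (-1)) = ((2 : ℝ≥0∞) ^ l)⁻¹ := by
    rw [mul_neg_one, ENNReal.rpow_neg, ENNReal.rpow_intCast]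
  rw [h2] at h1
  have h2l : (2 : ℝ≥0∞) ^ l ≠ 0 := (ENNReal.zpow_pos two_ne_zero ENNReal.ofNat_ne_top l).ne'
  unfold blockSup
  calc eLpNorm (blockFn l (u τ)) ∞ volume
      = 2 ^ l * ((2 ^ l)⁻¹ * eLpNorm (blockFn l (u τ)) ∞ volume) := by
        rw [← mul_assoc, ENNReal.mul_inv_cancel h2l (two_zpow_ne_top l), one_mul]
    _ ≤ 2 ^ l * ENNReal.ofReal (c * ν) := mul_le_mul_right h1 _
    _ = ((c * ν).toNNReal : ℝ≥0∞) * 2 ^ l := by rw [mul_comm]; rfl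

/-- **Cheskidov–Shvydkoy 2010, Lemma 3.2 (the `H¹` form), conditionally on Leray's regular local
theory.** Granting `leray_local_regular_H1` (Leray 1934 / Ożański–Pooley 2018, Thm. 6.30 with
Cor. 6.16: regular local solutions from `H¹` data with lifespan `c ν³ ‖∇u₀‖⁻⁴`), there is an absolute
`c > 0` such that every Leray–Hopf solution of the unforced system on `ℝ³ × [0,T)` whose high dyadic
blocks satisfy `limsup_q sup_{t∈(0,T)} 2^{-q}‖Δ̇_q u(t)‖_∞ < c ν` is `H¹`-regular on `(0, T]`
(`cheskidov_shvydkoy_dyadic_regular`). Proof: Leray's continuation in the `H¹` class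
(`leray_continuation_H1_of_leray_local_regular_H1`) reduces the claim to the boundedness of
`‖u(t)‖²_{H¹}` at the right end of every interval of regularity, which is the bootstrap
`exists_eH1NormSq_le_of_isH1RegularOn` fed by the a-priori estimate of
`CheskidovShvydkoyApriori.lean`; the constant `c = (18·2570·(C₂+1)(C_r+1))⁻¹` only involves the
Littlewood–Paley constants, the Young parameters being sized by `ν`, the energy and the Bernstein
scale. [cite: CheskidovShvydkoy2010, Lemma 3.2] -/
theorem cheskidov_shvydkoy_dyadic_regular_of_local_regular (h : leray_local_regular_H1) :
    cheskidov_shvydkoy_dyadic_regular := by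
  obtain ⟨c₀, hc₀, hreg⟩ := h
  set K := lpBounds (Fin 3) with hK
  set c : ℝ := (18 * 2570 * ((K.C₂ : ℝ) + 1) * ((K.Cr : ℝ) + 1))⁻¹ with hc
  have hcpos : 0 < c := by rw [hc]; positivity
  refine ⟨c, hcpos, fun ν T hν hT u₀ u U hLH hU hlim => ?_⟩
  -- the data of the bootstrap
  obtain ⟨J, hblock⟩ := exists_blockSup_le_of_limsup_lt hLH.memLp hU hlim
  obtain ⟨E₀, hE₀⟩ := exists_eLpNorm_slice_le hLH hν.le
  set κ : ℝ≥0 := (c * ν).toNNReal with hκ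
  have hMtop : K.cM J E₀ ≠ ∞ := K.cM_ne_top J ENNReal.coe_ne_top
  set M' : ℝ := (K.cM J E₀).toReal with hM'
  have hM'0 : 0 ≤ M' := ENNReal.toReal_nonneg
  set ε₁' : ℝ := ν / (18 * ((K.C₂ : ℝ) + 1) * (M' + 1)) / 20 with hε₁'
  set ε₂' : ℝ := ν / (18 * ((K.C₂ : ℝ) ^ 2 * E₀ + 1) * (M' + 1)) / (5 * (2 : ℝ) ^ (J + 4)) with hε₂'
  have hε₁'pos : 0 < ε₁' := by rw [hε₁']; positivity
  have hε₂'pos : 0 < ε₂' := by rw [hε₂']; positivity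
  set ε₁ : ℝ≥0 := ε₁'.toNNReal with hε₁
  set ε₂ : ℝ≥0 := ε₂'.toNNReal with hε₂
  have hε₁0 : ε₁ ≠ 0 := by rw [hε₁]; exact (Real.toNNReal_pos.2 hε₁'pos).ne'
  have hε₂0 : ε₂ ≠ 0 := by rw [hε₂]; exact (Real.toNNReal_pos.2 hε₂'pos).ne'
  -- the smallness `2 · 3 · α ≤ ν`
  have hsmall : 2 * Fintype.card (Fin 3) * K.cAlpha J κ E₀ ε₁ ε₂ ≤ ENNReal.ofReal ν := by
    -- each of the three terms is at most `ν / 18`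
    have hC₂ : (K.C₂ : ℝ≥0∞) = ENNReal.ofReal (K.C₂ : ℝ) := (ENNReal.ofReal_coe_nnreal).symm
    have hCr : (K.Cr : ℝ≥0∞) = ENNReal.ofReal (K.Cr : ℝ) := (ENNReal.ofReal_coe_nnreal).symm
    have hE : (E₀ : ℝ≥0∞) = ENNReal.ofReal (E₀ : ℝ) := (ENNReal.ofReal_coe_nnreal).symm
    have hM : K.cM J E₀ = ENNReal.ofReal M' := (ENNReal.ofReal_toReal hMtop).symm
    have hκ' : (κ : ℝ≥0∞) = ENNReal.ofReal (c * ν) := by rw [hκ]; rfl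
    have hε₁c : (ε₁ : ℝ≥0∞) = ENNReal.ofReal ε₁' := by rw [hε₁]; rfl
    have hε₂c : (ε₂ : ℝ≥0∞) = ENNReal.ofReal ε₂' := by rw [hε₂]; rfl
    have hcν : 0 ≤ c * ν := by positivity
    have hκr : (κ : ℝ) = c * ν := by rw [hκ]; exact Real.coe_toNNReal _ hcν
    have hε₁r : (ε₁ : ℝ) = ε₁' := by rw [hε₁]; exact Real.coe_toNNReal _ hε₁'pos.le
    have hε₂r : (ε₂ : ℝ) = ε₂' := by rw [hε₂]; exact Real.coe_toNNReal _ hε₂'pos.le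
    have hT1 : 20 * (K.C₂ : ℝ≥0∞) * K.cM J E₀ * ε₁ ≤ ENNReal.ofReal (ν / 18) := by
      have hfin : 20 * (K.C₂ : ℝ≥0∞) * K.cM J E₀ * ε₁ ≠ ∞ :=
        ENNReal.mul_ne_top (ENNReal.mul_ne_top (ENNReal.mul_ne_top (by norm_num) ENNReal.coe_ne_top) hMtop) ENNReal.coe_ne_top
      rw [ENNReal.le_ofReal_iff_toReal_le hfin (by positivity)]
      simp only [ENNReal.toReal_mul, ENNReal.toReal_ofNat, ENNReal.coe_toReal]
      rw [← hM', hε₁r]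
      have := mul_mul_div_le (K.C₂).2 hM'0 hν.le (by norm_num : (0 : ℝ) < 18)
      calc 20 * (K.C₂ : ℝ) * M' * ε₁' = (K.C₂ : ℝ) * M' * (ν / (18 * ((K.C₂ : ℝ) + 1) * (M' + 1))) := by
            rw [hε₁']; ring
        _ ≤ ν / 18 := this
    have hT2 : 2570 * (K.C₂ : ℝ≥0∞) * κ * K.Cr ≤ ENNReal.ofReal (ν / 18) := by
      have hfin : 2570 * (K.C₂ : ℝ≥0∞) * κ * K.Cr ≠ ∞ :=
        ENNReal.mul_ne_top (ENNReal.mul_ne_top (ENNReal.mul_ne_top (by norm_num) ENNReal.coe_ne_top) ENNReal.coe_ne_top)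
          ENNReal.coe_ne_top
      rw [ENNReal.le_ofReal_iff_toReal_le hfin (by positivity)]
      simp only [ENNReal.toReal_mul, ENNReal.toReal_ofNat, ENNReal.coe_toReal]
      rw [hκr]
      have h1 : (K.C₂ : ℝ) * (K.Cr : ℝ) ≤ ((K.C₂ : ℝ) + 1) * ((K.Cr : ℝ) + 1) := by
        nlinarith [(K.C₂).2, (K.Cr).2]
      calc 2570 * (K.C₂ : ℝ) * (c * ν) * K.Cr
          = ν / 18 * (((K.C₂ : ℝ) * K.Cr) / (((K.C₂ : ℝ) + 1) * ((K.Cr : ℝ) + 1))) := by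
            rw [hc]; field_simp
        _ ≤ ν / 18 * 1 := by
            gcongr; exact (div_le_one (by positivity)).2 h1
        _ = ν / 18 := mul_one _
    have hT3 : 5 * (K.C₂ : ℝ≥0∞) * (K.C₂ * E₀) * K.cM J E₀ * 2 ^ (J + 4) * ε₂ ≤ ENNReal.ofReal (ν / 18) := by
      have hfin : 5 * (K.C₂ : ℝ≥0∞) * (K.C₂ * E₀) * K.cM J E₀ * 2 ^ (J + 4) * ε₂ ≠ ∞ :=
        ENNReal.mul_ne_top (ENNReal.mul_ne_top (ENNReal.mul_ne_top (ENNReal.mul_ne_top (ENNReal.mul_ne_top (by norm_num)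
          ENNReal.coe_ne_top) (ENNReal.mul_ne_top ENNReal.coe_ne_top ENNReal.coe_ne_top)) hMtop) (two_zpow_ne_top _))
          ENNReal.coe_ne_top
      rw [ENNReal.le_ofReal_iff_toReal_le hfin (by positivity)]
      simp only [ENNReal.toReal_mul, ENNReal.toReal_ofNat, ENNReal.coe_toReal, toReal_two_zpow]
      rw [← hM', hε₂r]
      have := mul_mul_div_le (mul_nonneg (sq_nonneg (K.C₂ : ℝ)) (E₀).2) hM'0 hν.le (by norm_num : (0 : ℝ) < 18)
      have h2pos : (0 : ℝ) < (2 : ℝ) ^ (J + 4) := zpow_pos two_pos _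
      calc 5 * (K.C₂ : ℝ) * ((K.C₂ : ℝ) * E₀) * M' * (2 : ℝ) ^ (J + 4) * ε₂'
          = (K.C₂ : ℝ) ^ 2 * E₀ * M' * (ν / (18 * ((K.C₂ : ℝ) ^ 2 * E₀ + 1) * (M' + 1))) := by
            rw [hε₂']; field_simp
        _ ≤ ν / 18 := this
    have hsum : K.cAlpha J κ E₀ ε₁ ε₂ ≤ ENNReal.ofReal (ν / 18) + ENNReal.ofReal (ν / 18) + ENNReal.ofReal (ν / 18) := by
      unfold LPBounds.cAlpha
      exact add_le_add (add_le_add hT1 hT2) hT3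
    calc 2 * (Fintype.card (Fin 3) : ℝ≥0∞) * K.cAlpha J κ E₀ ε₁ ε₂
        ≤ 2 * (Fintype.card (Fin 3) : ℝ≥0∞) * (ENNReal.ofReal (ν / 18) + ENNReal.ofReal (ν / 18) + ENNReal.ofReal (ν / 18)) := by
          gcongr
      _ = ENNReal.ofReal ν := by
          rw [Fintype.card_fin, ← ENNReal.ofReal_add (by positivity) (by positivity),
            ← ENNReal.ofReal_add (by positivity) (by positivity), Nat.cast_ofNat, ← ENNReal.ofReal_ofNat 2,
            ← ENNReal.ofReal_ofNat 3, ← ENNReal.ofReal_mul (by norm_num), ← ENNReal.ofReal_mul (by norm_num)]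
          congr 1; ring
  -- Leray's continuation in the `H¹` class
  refine leray_continuation_H1_of_leray_local_regular_H1 ⟨c₀, hc₀, hreg⟩ ν T hν hT u₀ u hLH
    fun α β hα hαβ hβT hregI => ?_
  obtain ⟨s₁, hs₁, M, hM, hbound⟩ := exists_eH1NormSq_le_of_isH1RegularOn K hν hLH hc₀ hreg hblock hE₀ hε₁0 hε₂0
    hsmall hα hαβ hβT hregI
  refine lt_of_le_of_lt (Filter.limsup_le_of_le ?_ ?_) hM
  · isBoundedDefault
  · filter_upwards [Ico_mem_nhdsLT hs₁.2] with t ht using hbound t ht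

/-- **Cheskidov–Shvydkoy 2010, Theorem 3.1, from the two classical named facts.** The regularity
criterion in `B^{-1}_{∞,∞}` (`cheskidov_shvydkoy`, ns.S31) follows from Leray's regular local
theory in `H¹` (`leray_local_regular_H1`: Leray 1934; Ożański–Pooley 2018, Thm. 6.30, Cor. 6.16)
and the Ladyzhenskaya–Prodi–Serrin smoothness theorem (`ladyzhenskaya_prodi_serrin`, ns.S07), the
Littlewood–Paley part (Lemma 3.2) being proved in the tree
(`cheskidov_shvydkoy_dyadic_regular_of_local_regular`). [cite: CheskidovShvydkoy2010, Thm. 3.1] -/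
theorem cheskidov_shvydkoy_of_leray_local_regular_H1 (hloc : leray_local_regular_H1)
    (hLPS : ladyzhenskaya_prodi_serrin) : cheskidov_shvydkoy :=
  cheskidov_shvydkoy_of_local_regular (cheskidov_shvydkoy_dyadic_regular_of_local_regular hloc) hloc hLPS

/-- **Cheskidov–Shvydkoy 2010, Theorem 3.1, from the local `H¹` theory alone.** Combining with the
tree's reduction of the Ladyzhenskaya–Prodi–Serrin theorem to the local `H¹` theory
(`ladyzhenskaya_prodi_serrin_of_local_H1_theory`), the trust base of ns.S31 becomes
`leray_local_regular_H1` (which implies `leray_local_strong_H1`) and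
`tao2011_H1_local_almost_regular`. [cite: CheskidovShvydkoy2010, Thm. 3.1] -/
theorem cheskidov_shvydkoy_of_local_H1_theory (hloc : leray_local_regular_H1)
    (h₂ : tao2011_H1_local_almost_regular) : cheskidov_shvydkoy :=
  cheskidov_shvydkoy_of_leray_local_regular_H1 hloc
    (ladyzhenskaya_prodi_serrin_of_local_H1_theory (leray_local_strong_H1_of_regular hloc) h₂)

end Final

end Literature.Analysis.FluidPDE

end
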